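import Literature.Combinatorics.Optimization.HexagonComplexPsdRank
import HarnessLib

/-!
# The pentagon is not `ℂ`-psd-minimal (Goucha–Gouveia–Silva 2017, §4: Thm. 4.1, Thm. 4.2, Lemma 4.6,
# Cor. 4.7 for polygons) — all PROVED

Source: A. P. Goucha, J. Gouveia, P. M. Silva, *On ranks of regular polygons*, SIAM J. Discrete Math.
31 (2017) 2612–2625 = arXiv:1610.09868 [GouchaGouveiaSilva2017]; held text `paper:arxiv-1610.09868`,
p09–p10 (`pNN` = held-text chunk). Companion of `HexagonComplexPsdRank.lean` (the notion
`HasComplexPsdFactorization`, Theorem 4.1's bound `rank_psd^ℂ S_P ≥ 3` for polygons, and Remark 4.8: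
the hexagon IS `ℂ`-psd-minimal).

Printed statements (p09, verbatim). "**Theorem 4.1.** Let `S_P` be the slack matrix of a `d`-polytope
`P`. Then `rank_psd^ℂ S_P ≥ d+1`. Furthermore, when equality holds, every ℂ-factorization of size
`d+1` of `S_P` uses only rank one matrices as factors. [...] **Theorem 4.2.** A `d`-polytope `P` with
slack matrix `S_P ∈ ℝ^{f×v}_+` is psd^ℂ-minimal if and only if there exists a matrix `M ∈ ℂ^{f×v}`
with `rank M = d+1` such that `S_P = |M| ⊙ |M|`. [...] **Lemma 4.6** (Combined Trinomial
Obstructions). Consider a psd^ℂ-minimal `d`-polytope `P` with slack matrix `S_P`. If its symbolic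
slack matrix `S_P(x)` has a `d+2`-minor that is of the form `x^a − x^b + x^c`, then, for every
`ζ ∈ ℂ^t` such that `S_P = |S_P(ζ)| ⊙ |S_P(ζ)|`, with `rank S_P(ζ) = d+1`, we have `Re(ζ^c/ζ^a) = 0`.
[...] **Corollary 4.7.** The pentagon is not psd^ℂ-minimal." The printed proof of 4.7 (p10): the
`4`-minors `m_{5,5} = x₁ − x₃x₄ + 1`, `m_{5,1} = x₄ − x₁x₂ + 1`, `m_{3,4} = x₂ − x₄x₅ + 1` of the
rescaled symbolic slack matrix force `ζ₁, ζ₂, ζ₄` pure imaginary, and then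
`m_{5,1}(ζ) = ζ₄ − ζ₁ζ₂ + 1 = 0` is impossible.

## Contents (polygons, `d = 2`; the polygon is a vertex list `x : Fin m → ℝ²` in strictly convex
position, `IsConvexPolygon x`, with vertex/edge slack matrix `polygonSlack x`, as everywhere in the
tree)

* `eq_vecMulVec_of_trace_pattern` — the rank-one mechanism behind Theorem 4.1's second statement, for
  `3 × 3` complex factors: if `Tr(X_{r₁}Y_c) = Tr(X_{r₂}Y_c) = Tr(X_{r₂}Y_{c'}) = 0 ≠ Tr(X_{r₁}Y_{c'})`
  and `X_{r₂} ≠ 0` then `Y_c = vv^*` (kernel dimension count in `ℂ³`; GRT13's polarity-free local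
  form, cf. `PsdMinimalPolytopes.lean` for the real case);
  `IsConvexPolygon.eq_vecMulVec_of_hasComplexPsdFactorization_three` — **Theorem 4.1, second
  statement, for every convex `m`-gon**, `m ≥ 3`: all factors of a size-`3` ℂ-factorization are `vv^*`.
* `IsConvexPolygon.hasComplexPsdFactorization_three_iff` — **Theorem 4.2 for polygons**: a size-`3`
  ℂ-factorization exists iff `S_{ij} = |u_i · v_j|²` with `u_i, v_j ∈ ℂ³` (i.e. `S_P = |M| ⊙ |M|`
  with `M` factoring through `ℂ³`; `⇐` is `HasComplexPsdFactorization.of_normSq`).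
* `re_mul_conj_eq_zero_of_trinomial` — **Lemma 4.6**'s mechanism (`b = a + c`, `|b|² = |a|² + |c|²`
  `⇒ Re(a c̄) = 0`); `pentagon_trinomial_minors` — the three printed minors, UNSCALED, as identities
  `T_b = T_a + T_c` for any `5 × 5` matrix with the pentagon's zero pattern and vanishing `4`-minors
  (over any commutative ring, so that they serve for `S_P(ζ)` and for `S_P = |S_P(ζ)|²` alike);
  `pentagon_trinomial_obstruction` — the contradiction, done on scale-invariant ratios instead of the
  printed rescaling of nine entries to `1` (Remark 4.5): `q₁ = z₁₄z₂₁z₄₃/(z₁₃z₂₄z₄₁)`,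
  `q₂ = z₁₃z₂₅z₄₁/(z₁₅z₂₁z₄₃)`, `q₃ = z₁₃z₃₅z₄₂/(z₁₅z₃₂z₄₃)` are imaginary by Lemma 4.6 while
  `m_{5,1}(ζ) = 0` reads `q₁q₂ = q₃ + 1`, whence `q₃ ∈ ℝ ∩ iℝ`, `q₃ = 0` — impossible.
* `IsConvexPolygon.not_hasComplexPsdFactorization_three_pentagon` = `GouchaGouveiaSilva2017_cor47` —
  **Corollary 4.7**: no convex pentagon has a ℂ-factorization of size `3`; with the tree's real
  factorization of size `4` (`IsConvexPolygon.hasPsdFactorization_four_pentagon`, GRT15) and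
  Theorem 4.1's lower bound: `IsConvexPolygon.complexPsdRank_pentagon` — **the complex psd rank of
  every convex pentagon is exactly `4`**.

* (appended) `add_one_le_of_hasComplexPsdFactorization_slack`, `GouchaGouveiaSilva2017_thm41` —
  **Theorem 4.1, first statement, in every dimension** (`rank_psd^ℂ S_P ≥ dim P + 1` for
  `V`/`H`-described polytopes), by the flag `exists_slack_triangular` of
  `PolytopePsdRankLowerBound.lean` and `HasComplexPsdFactorization.card_le_of_triangular`.

Orientation: the paper's slack matrix has `S_{pp} = S_{p,p+1} = 0` (rows = facets); the tree's
`polygonSlack x i j = 0 ⟺ i ∈ {j, j+1}` (rows = vertices); the relabelling `p ↦ −p (mod 5)` of both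
indices (`![0,4,3,2,1]`) matches the printed pattern, so the printed minors are used verbatim
(0-based in Lean). Not here: the rank-one statement of Theorem 4.1 and Theorem 4.2 for `d ≥ 3`.
-/

noncomputable section

open Matrix Finset

open scoped MatrixOrder ComplexOrder

namespace Literature.Combinatorics.Optimization

/-! ### Plumbing: kernels of psd matrices, `CᴴC` as a sum of rank-one matrices -/

/-- `Tr(P · CᴴC) = 0` with `P ⪰ 0` forces `P c̄_l = 0` for every row `c_l` of `C`
(`Tr(P CᴴC) = Σ_l c̄_l^* P c̄_l`, nonnegative terms). [folklore] -/
private theorem mulVec_star_eq_zero_of_trace {n : Type*} [Fintype n] [DecidableEq n]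
    {P : Matrix n n ℂ} (hP : P.PosSemidef) (C : Matrix n n ℂ) (h : (P * (Cᴴ * C)).trace = 0) :
    ∀ l, P *ᵥ star (C l) = 0 := by
  have hsum : (P * (Cᴴ * C)).trace = ∑ l, star (star (C l)) ⬝ᵥ (P *ᵥ star (C l)) := by
    rw [← Matrix.mul_assoc, Matrix.trace_mul_comm]
    simp only [Matrix.trace, Matrix.diag_apply, Matrix.mul_apply, Matrix.conjTranspose_apply,
      dotProduct, Matrix.mulVec, Finset.mul_sum, star_star, Pi.star_apply]
  have hnn : ∀ l, 0 ≤ star (star (C l)) ⬝ᵥ (P *ᵥ star (C l)) := fun l =>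
    hP.dotProduct_mulVec_nonneg (star (C l))
  have hzero : ∀ l, star (star (C l)) ⬝ᵥ (P *ᵥ star (C l)) = 0 := by
    have h0 : ∑ l, star (star (C l)) ⬝ᵥ (P *ᵥ star (C l)) = 0 := by rw [← hsum, h]
    exact fun l => (Finset.sum_eq_zero_iff_of_nonneg fun l _ => hnn l).1 h0 l (Finset.mem_univ l)
  exact fun l => (hP.dotProduct_mulVec_zero_iff _).1 (hzero l)

/-- `P c̄_l = 0` for all rows of `C` gives `P · CᴴC = 0`, hence `Tr(P · CᴴC) = 0`. [folklore] -/
private theorem trace_eq_zero_of_mulVec_star_eq_zero {n : Type*} [Fintype n] [DecidableEq n]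
    (P C : Matrix n n ℂ) (h : ∀ l, P *ᵥ star (C l) = 0) : (P * (Cᴴ * C)).trace = 0 := by
  have hPC : P * Cᴴ = 0 := by
    ext s l
    have := congrFun (h l) s
    simpa only [Matrix.mul_apply, Matrix.conjTranspose_apply, Matrix.mulVec, dotProduct,
      Matrix.zero_apply, Pi.zero_apply, Pi.star_apply] using this
  rw [← Matrix.mul_assoc, hPC, Matrix.zero_mul, trace_zero]

/-- `CᴴC = Σ_l c̄_l c̄_l^*` (rows `c_l` of `C`). [folklore] -/
private theorem conjTranspose_mul_self_eq_sum {n : Type*} [Fintype n] (C : Matrix n n ℂ) :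
    Cᴴ * C = ∑ l, vecMulVec (star (C l)) (star (star (C l))) := by
  ext s t
  simp only [Matrix.mul_apply, Matrix.conjTranspose_apply, Matrix.sum_apply, vecMulVec_apply,
    star_star, Pi.star_apply]

/-- A nonzero `3 × 3` complex matrix has kernel of dimension `≤ 2`. [folklore] -/
private theorem finrank_ker_le_two {P : Matrix (Fin 3) (Fin 3) ℂ} (hP : P ≠ 0) :
    Module.finrank ℂ (LinearMap.ker P.mulVecLin) ≤ 2 := by
  have hne : LinearMap.ker P.mulVecLin ≠ ⊤ := by
    intro htop
    apply hP
    ext s t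
    have hmem : (Pi.single t 1 : Fin 3 → ℂ) ∈ LinearMap.ker P.mulVecLin := by
      rw [htop]; exact Submodule.mem_top
    have hcol : P *ᵥ Pi.single t 1 = 0 := LinearMap.mem_ker.mp hmem
    have := congrFun hcol s
    simp only [Matrix.mulVec, dotProduct_single, mul_one, Pi.zero_apply] at this
    rw [this, Matrix.zero_apply]
  have h := Submodule.finrank_lt hne
  rw [Module.finrank_fin_fun] at h
  omega

/-- **The rank-one mechanism of GGS Theorem 4.1 for `d = 2`** (GRT13 Prop. 3.2 / Thm. 3.5 in the
complex setting, p09: "when equality holds, every ℂ-factorization of size `d+1` of `S_P` uses only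
rank one matrices as factors"), as a statement about two families of `3 × 3` Hermitian psd matrices
`X_r`, `Y_c`: if `Tr(X_{r₁}Y_c) = Tr(X_{r₂}Y_c) = Tr(X_{r₂}Y_{c'}) = 0` while `Tr(X_{r₁}Y_{c'}) ≠ 0` and
`X_{r₂} ≠ 0`, then `Y_c = vv^*`. (Write `Y_c = CᴴC`; the conjugate rows of `C` lie in
`ker X_{r₁} ∩ ker X_{r₂}`; if they span a plane it IS both kernels (dimension count in `ℂ³`), and then
`Y_{c'}`, killed by `X_{r₂}`, is killed by `X_{r₁}` too — contradiction; so they span a line.)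
[cite: GouchaGouveiaSilva2017, Thm. 4.1 (p09)] -/
theorem eq_vecMulVec_of_trace_pattern {α β : Type*} {X : α → Matrix (Fin 3) (Fin 3) ℂ}
    {Y : β → Matrix (Fin 3) (Fin 3) ℂ} (hX : ∀ r, (X r).PosSemidef) (hY : ∀ c, (Y c).PosSemidef)
    {r₁ r₂ : α} {c c' : β} (h1 : (X r₁ * Y c).trace = 0) (h2 : (X r₂ * Y c).trace = 0)
    (h3 : (X r₂ * Y c').trace = 0) (h4 : (X r₁ * Y c').trace ≠ 0) (h5 : X r₂ ≠ 0) :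
    ∃ v : Fin 3 → ℂ, Y c = vecMulVec v (star v) := by
  classical
  obtain ⟨C, hC⟩ := CStarAlgebra.nonneg_iff_eq_star_mul_self.mp (hY c).nonneg
  have hYC : Y c = Cᴴ * C := by rw [hC, star_eq_conjTranspose]
  have hk1 : ∀ l, X r₁ *ᵥ star (C l) = 0 :=
    mulVec_star_eq_zero_of_trace (hX r₁) C (by rw [← hYC]; exact h1)
  have hk2 : ∀ l, X r₂ *ᵥ star (C l) = 0 :=
    mulVec_star_eq_zero_of_trace (hX r₂) C (by rw [← hYC]; exact h2)
  let V : Submodule ℂ (Fin 3 → ℂ) := Submodule.span ℂ (Set.range fun l => star (C l))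
  have hV1 : V ≤ LinearMap.ker (X r₁).mulVecLin := Submodule.span_le.mpr (by
    rintro _ ⟨l, rfl⟩; exact LinearMap.mem_ker.mpr (hk1 l))
  have hV2 : V ≤ LinearMap.ker (X r₂).mulVecLin := Submodule.span_le.mpr (by
    rintro _ ⟨l, rfl⟩; exact LinearMap.mem_ker.mpr (hk2 l))
  by_cases hdim : Module.finrank ℂ V ≤ 1
  · -- the conjugate rows lie on a line `ℂ v₀`: `Y_c = (Σ|r_l|²) v₀v₀^*`
    obtain ⟨v₀, hv₀⟩ := finrank_le_one_iff.mp hdim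
    have hc : ∀ l, ∃ r : ℂ, r • (v₀ : Fin 3 → ℂ) = star (C l) := fun l => by
      obtain ⟨r, hr⟩ := hv₀ ⟨star (C l), Submodule.subset_span ⟨l, rfl⟩⟩
      exact ⟨r, by simpa using congrArg Subtype.val hr⟩
    choose r hr using hc
    let s : ℝ := Real.sqrt (∑ l, Complex.normSq (r l))
    have hs2 : ((s : ℂ)) * (s : ℂ) = ∑ l, r l * (starRingEnd ℂ) (r l) := by
      rw [← Complex.ofReal_mul, Real.mul_self_sqrt (Finset.sum_nonneg fun l _ => Complex.normSq_nonneg _),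
        Complex.ofReal_sum]
      exact Finset.sum_congr rfl fun l _ => by rw [Complex.mul_conj]
    refine ⟨(s : ℂ) • (v₀ : Fin 3 → ℂ), ?_⟩
    rw [hYC, conjTranspose_mul_self_eq_sum]
    ext a b
    simp only [Matrix.sum_apply, vecMulVec_apply, Pi.smul_apply, Pi.star_apply, smul_eq_mul,
      star_star, star_mul', Complex.star_def, Complex.conj_ofReal]
    have e : ∀ l, star (C l a) * C l b =
        (r l * star (r l)) * ((v₀ : Fin 3 → ℂ) a * star ((v₀ : Fin 3 → ℂ) b)) := fun l => by
      have ha := congrFun (hr l) a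
      have hb := congrFun (hr l) b
      simp only [Pi.smul_apply, smul_eq_mul, Pi.star_apply] at ha hb
      have hb' : C l b = star (r l * (v₀ : Fin 3 → ℂ) b) := by rw [hb, star_star]
      rw [← ha, hb', star_mul']
      ring
    simp only [Complex.star_def] at e
    rw [Finset.sum_congr rfl fun l _ => e l, ← Finset.sum_mul, ← hs2]
    ring
  · -- the conjugate rows span a plane: it is `ker X_{r₁} = ker X_{r₂}`
    have hdim2 : 2 ≤ Module.finrank ℂ V := by omega
    have hX1 : X r₁ ≠ 0 := by
      rintro h0; apply h4; rw [h0, Matrix.zero_mul, trace_zero]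
    have hK1 : V = LinearMap.ker (X r₁).mulVecLin :=
      Submodule.eq_of_le_of_finrank_le hV1 ((finrank_ker_le_two hX1).trans hdim2)
    have hK2 : V = LinearMap.ker (X r₂).mulVecLin :=
      Submodule.eq_of_le_of_finrank_le hV2 ((finrank_ker_le_two h5).trans hdim2)
    obtain ⟨C', hC'⟩ := CStarAlgebra.nonneg_iff_eq_star_mul_self.mp (hY c').nonneg
    have hYC' : Y c' = C'ᴴ * C' := by rw [hC', star_eq_conjTranspose]
    have hk3 : ∀ l, X r₂ *ᵥ star (C' l) = 0 :=
      mulVec_star_eq_zero_of_trace (hX r₂) C' (by rw [← hYC']; exact h3)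
    have hk4 : ∀ l, X r₁ *ᵥ star (C' l) = 0 := fun l => by
      have hmem : star (C' l) ∈ LinearMap.ker (X r₂).mulVecLin := LinearMap.mem_ker.mpr (hk3 l)
      rw [← hK2, hK1] at hmem
      exact LinearMap.mem_ker.mp hmem
    exact absurd (by rw [hYC']; exact trace_eq_zero_of_mulVec_star_eq_zero _ _ hk4) h4

/-- `Tr(aa^* · bb^*) = |a^*b|²`. [folklore] -/
private theorem trace_vecMulVec_mul_vecMulVec (a b : Fin 3 → ℂ) :
    (vecMulVec a (star a) * vecMulVec b (star b)).trace =
      ((Complex.normSq (star a ⬝ᵥ b) : ℝ) : ℂ) := by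
  rw [← Complex.mul_conj]
  simp only [trace, diag_apply, mul_apply, vecMulVec_apply, dotProduct, Pi.star_apply,
    Complex.star_def, map_sum, map_mul, Complex.conj_conj, Finset.sum_mul_sum]
  rw [Finset.sum_comm]
  exact Finset.sum_congr rfl fun s _ => Finset.sum_congr rfl fun t _ => by ring


/-! ### Plumbing: `4 × 4` minors of a matrix factoring through `ℂ³` (or `ℝ³`) vanish -/

/-- `rank < #rows` yields a nonzero left kernel vector (any field). [folklore] -/
private theorem exists_vecMul_eq_zero_of_rank_lt {K : Type*} [Field K] {p q : Type*} [Fintype p]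
    [Fintype q] [DecidableEq p] (N : Matrix p q K) (h : N.rank < Fintype.card p) :
    ∃ v : p → K, v ≠ 0 ∧ v ᵥ* N = 0 := by
  classical
  have h2 : Nᵀ.rank + Module.finrank K (LinearMap.ker Nᵀ.mulVecLin) = Fintype.card p := by
    have := LinearMap.finrank_range_add_finrank_ker Nᵀ.mulVecLin
    rw [Module.finrank_fintype_fun_eq_card] at this
    exact this
  rw [Matrix.rank_transpose] at h2
  have h1 : 0 < Module.finrank K (LinearMap.ker Nᵀ.mulVecLin) := by omega
  obtain ⟨⟨v, hv⟩, hne⟩ := Module.finrank_pos_iff_exists_ne_zero.mp h1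
  refine ⟨v, fun h0 => hne (Subtype.ext h0), ?_⟩
  rw [LinearMap.mem_ker, Matrix.mulVecLin_apply, Matrix.mulVec_transpose] at hv
  exact hv

/-- A `4 × 4` submatrix of a product `P Q` through `ℂ³` is singular. [folklore] -/
private theorem det_submatrix_mul_eq_zero {ι κ : Type*} (P : Matrix ι (Fin 3) ℂ)
    (Q : Matrix (Fin 3) κ ℂ) (f : Fin 4 → ι) (g : Fin 4 → κ) :
    (Matrix.of fun a b => (P * Q) (f a) (g b)).det = 0 := by
  have h : (Matrix.of fun a b => (P * Q) (f a) (g b)) = P.submatrix f id * Q.submatrix id g := by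
    ext a b
    simp [Matrix.mul_apply]
  rw [h]
  obtain ⟨v, hv, hvN⟩ := exists_vecMul_eq_zero_of_rank_lt (P.submatrix f id * Q.submatrix id g)
    (calc (P.submatrix f id * Q.submatrix id g).rank ≤ (P.submatrix f id).rank := rank_mul_le_left _ _
      _ ≤ Fintype.card (Fin 3) := rank_le_card_width _
      _ < Fintype.card (Fin 4) := by simp)
  exact Matrix.exists_vecMul_eq_zero_iff.mp ⟨v, hv, hvN⟩

/-! ### The combined trinomial obstruction for the pentagon (Lemma 4.6, Corollary 4.7) -/

/-- **GGS Lemma 4.6, the mechanism** (p09: from `ζ^a − ζ^b + ζ^c = 0` and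
`|ζ^a|² − |ζ^b|² + |ζ^c|² = 0` one gets `conj(ζ^a)ζ^c + ζ^a conj(ζ^c) = 0`): `b = a + c` and
`|b|² = |a|² + |c|²` force `Re(a c̄) = 0`. [cite: GouchaGouveiaSilva2017, Lemma 4.6 (p09)] -/
theorem re_mul_conj_eq_zero_of_trinomial {a b c : ℂ} (h : b = a + c)
    (h' : Complex.normSq b = Complex.normSq a + Complex.normSq c) :
    (a * (starRingEnd ℂ) c).re = 0 := by
  rw [h, Complex.normSq_add] at h'
  linarith

/-- The three `4 × 4` minors `m_{5,5}, m_{5,1}, m_{3,4}` of a `5 × 5` matrix with the pentagon's zero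
pattern `z_{pp} = z_{p,p+1} = 0` are the trinomials of the proof of Corollary 4.7 (unscaled form).
[cite: GouchaGouveiaSilva2017, Cor. 4.7 proof (p10, the minors m_{5,5}, m_{5,1}, m_{3,4})] -/
theorem pentagon_trinomial_minors {R : Type*} [CommRing R] (z : Fin 5 → Fin 5 → R)
    (h0 : ∀ p q : Fin 5, (q = p ∨ q = p + 1) → z p q = 0)
    (hdet : ∀ f g : Fin 4 → Fin 5, (Matrix.of fun a b => z (f a) (g b)).det = 0) :
    z 0 2 * z 1 3 * z 2 0 * z 3 1 = z 0 2 * z 1 3 * z 2 1 * z 3 0 + z 0 3 * z 1 0 * z 2 1 * z 3 2 ∧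
    z 0 3 * z 1 4 * z 2 1 * z 3 2 = z 0 2 * z 1 3 * z 2 4 * z 3 1 + z 0 4 * z 1 3 * z 2 1 * z 3 2 ∧
    z 0 4 * z 1 0 * z 3 1 * z 4 2 = z 0 2 * z 1 4 * z 3 0 * z 4 1 + z 0 4 * z 1 0 * z 3 2 * z 4 1 := by
  have h00 := h0 0 0 (by decide)
  have h01 := h0 0 1 (by decide)
  have h11 := h0 1 1 (by decide)
  have h12 := h0 1 2 (by decide)
  have h22 := h0 2 2 (by decide)
  have h23 := h0 2 3 (by decide)
  have h33 := h0 3 3 (by decide)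
  have h34 := h0 3 4 (by decide)
  have h44 := h0 4 4 (by decide)
  have h40 := h0 4 0 (by decide)
  have m1 := hdet ![0, 1, 2, 3] ![0, 1, 2, 3]
  have m2 := hdet ![0, 1, 2, 3] ![1, 2, 3, 4]
  have m3 := hdet ![0, 1, 3, 4] ![0, 1, 2, 4]
  simp [Matrix.det_succ_row_zero, Fin.sum_univ_succ, Matrix.submatrix_apply, Fin.succAbove, h00, h01,
    h11, h12, h22, h23, h33, h34, h44, h40] at m1 m2 m3
  refine ⟨?_, ?_, ?_⟩
  · linear_combination m1
  · linear_combination m2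
  · linear_combination -m3

/-- **The contradiction of Corollary 4.7, unscaled**: no `5 × 5` complex matrix `Z` with the pentagon's
zero/nonzero pattern satisfies the three trinomial minor relations together with their absolute-value
squares (the corresponding minors of `|Z| ⊙ |Z|`). The printed proof first rescales nine entries to `1`
(Remark 4.5) and reads off "`ζ₁, ζ₂, ζ₄` pure imaginary, `ζ₄ − ζ₁ζ₂ + 1 = 0`, contradiction"; here the
same is done on the scale-invariant ratios: `q₁ = z₁₄z₂₁z₄₃/(z₁₃z₂₄z₄₁)`, `q₂ = z₁₃z₂₅z₄₁/(z₁₅z₂₁z₄₃)`,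
`q₃ = z₁₃z₃₅z₄₂/(z₁₅z₃₂z₄₃)` are imaginary (Lemma 4.6 on `m_{5,5}, m_{3,4}, m_{5,1}`) while
`m_{5,1}(ζ) = 0` reads `q₁q₂ = q₃ + 1`, so `q₃ ∈ ℝ ∩ iℝ = {0}` (indices 1-based as printed; the Lean
statement is 0-based). [cite: GouchaGouveiaSilva2017, Cor. 4.7 (p09–p10)] -/
theorem pentagon_trinomial_obstruction (z : Fin 5 → Fin 5 → ℂ)
    (hnz : ∀ p q : Fin 5, q ≠ p → q ≠ p + 1 → z p q ≠ 0)
    (hA : z 0 2 * z 1 3 * z 2 0 * z 3 1 = z 0 2 * z 1 3 * z 2 1 * z 3 0 + z 0 3 * z 1 0 * z 2 1 * z 3 2)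
    (hA' : Complex.normSq (z 0 2 * z 1 3 * z 2 0 * z 3 1) =
      Complex.normSq (z 0 2 * z 1 3 * z 2 1 * z 3 0) + Complex.normSq (z 0 3 * z 1 0 * z 2 1 * z 3 2))
    (hB : z 0 3 * z 1 4 * z 2 1 * z 3 2 = z 0 2 * z 1 3 * z 2 4 * z 3 1 + z 0 4 * z 1 3 * z 2 1 * z 3 2)
    (hB' : Complex.normSq (z 0 3 * z 1 4 * z 2 1 * z 3 2) =
      Complex.normSq (z 0 2 * z 1 3 * z 2 4 * z 3 1) + Complex.normSq (z 0 4 * z 1 3 * z 2 1 * z 3 2))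
    (hC : z 0 4 * z 1 0 * z 3 1 * z 4 2 = z 0 2 * z 1 4 * z 3 0 * z 4 1 + z 0 4 * z 1 0 * z 3 2 * z 4 1)
    (hC' : Complex.normSq (z 0 4 * z 1 0 * z 3 1 * z 4 2) =
      Complex.normSq (z 0 2 * z 1 4 * z 3 0 * z 4 1) + Complex.normSq (z 0 4 * z 1 0 * z 3 2 * z 4 1)) :
    False := by
  have hα := re_mul_conj_eq_zero_of_trinomial hA hA'
  have hβ := re_mul_conj_eq_zero_of_trinomial hC hC'
  have hγ := re_mul_conj_eq_zero_of_trinomial hB hB'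
  -- the scale-invariant phase `κ = z₀₃ z₁₄ conj(z₀₄ z₁₃)` is real:
  set κ : ℂ := z 0 3 * z 1 4 * (starRingEnd ℂ) (z 0 4 * z 1 3) with hκdef
  set W : ℂ := z 1 0 * z 2 1 * z 0 2 * z 3 0 * z 4 1 * z 3 2 with hWdef
  have hW : W ≠ 0 := by
    simp only [hWdef]
    refine mul_ne_zero (mul_ne_zero (mul_ne_zero (mul_ne_zero (mul_ne_zero ?_ ?_) ?_) ?_) ?_) ?_ <;>
      exact hnz _ _ (by decide) (by decide)
  have e1 : (z 0 2 * z 1 3 * z 2 1 * z 3 0 * (starRingEnd ℂ) (z 0 3 * z 1 0 * z 2 1 * z 3 2)) *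
      (starRingEnd ℂ) (z 0 2 * z 1 4 * z 3 0 * z 4 1 * (starRingEnd ℂ) (z 0 4 * z 1 0 * z 3 2 * z 4 1)) =
      (W * (starRingEnd ℂ) W) * (starRingEnd ℂ) κ := by
    simp only [hκdef, hWdef, map_mul, Complex.conj_conj]
    ring
  have hκ : κ.im = 0 := by
    have h1 : ((z 0 2 * z 1 3 * z 2 1 * z 3 0 * (starRingEnd ℂ) (z 0 3 * z 1 0 * z 2 1 * z 3 2)) *
        (starRingEnd ℂ) (z 0 2 * z 1 4 * z 3 0 * z 4 1 *
          (starRingEnd ℂ) (z 0 4 * z 1 0 * z 3 2 * z 4 1))).im = 0 := by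
      rw [Complex.mul_im, hα, zero_mul, zero_add, Complex.conj_re, hβ, mul_zero]
    rw [e1, Complex.mul_im, Complex.mul_conj, Complex.ofReal_im, zero_mul, add_zero, Complex.ofReal_re,
      Complex.conj_im, mul_neg, neg_eq_zero] at h1
    exact (mul_eq_zero.mp h1).resolve_left fun h0 => hW (Complex.normSq_eq_zero.mp h0)
  -- hence `T_b' conj(T_c')` is real, and so is `γ = T_a' conj(T_c') = T_b' conj(T_c') − |T_c'|²`
  have e2 : z 0 3 * z 1 4 * z 2 1 * z 3 2 * (starRingEnd ℂ) (z 0 4 * z 1 3 * z 2 1 * z 3 2) =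
      (z 2 1 * z 3 2) * (starRingEnd ℂ) (z 2 1 * z 3 2) * κ := by
    simp only [hκdef, map_mul]
    ring
  have hγim : (z 0 2 * z 1 3 * z 2 4 * z 3 1 * (starRingEnd ℂ) (z 0 4 * z 1 3 * z 2 1 * z 3 2)).im = 0 := by
    have e3 : z 0 2 * z 1 3 * z 2 4 * z 3 1 * (starRingEnd ℂ) (z 0 4 * z 1 3 * z 2 1 * z 3 2) =
        (z 2 1 * z 3 2) * (starRingEnd ℂ) (z 2 1 * z 3 2) * κ -
          (z 0 4 * z 1 3 * z 2 1 * z 3 2) * (starRingEnd ℂ) (z 0 4 * z 1 3 * z 2 1 * z 3 2) := by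
      rw [← e2, ← sub_mul, hB, add_sub_cancel_right]
    rw [e3]
    simp only [Complex.sub_im, Complex.mul_im, Complex.mul_conj, Complex.ofReal_im, Complex.ofReal_re, hκ,
      mul_zero, zero_mul, add_zero, sub_zero]
  -- so `γ = 0`: one of its (nonzero) factors vanishes
  have hγ0 : z 0 2 * z 1 3 * z 2 4 * z 3 1 * (starRingEnd ℂ) (z 0 4 * z 1 3 * z 2 1 * z 3 2) = 0 :=
    Complex.ext hγ hγim
  have hTa : z 0 2 * z 1 3 * z 2 4 * z 3 1 ≠ 0 := by
    refine mul_ne_zero (mul_ne_zero (mul_ne_zero ?_ ?_) ?_) ?_ <;> exact hnz _ _ (by decide) (by decide)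
  have hTc : z 0 4 * z 1 3 * z 2 1 * z 3 2 ≠ 0 := by
    refine mul_ne_zero (mul_ne_zero (mul_ne_zero ?_ ?_) ?_) ?_ <;> exact hnz _ _ (by decide) (by decide)
  rcases mul_eq_zero.mp hγ0 with h | h
  · exact hTa h
  · exact hTc ((map_eq_zero (starRingEnd ℂ)).mp h)

/-! ### Theorems 4.1 (rank-one factors) and 4.2 for polygons -/

/-- Index bookkeeping in `Fin (n+3)`: `1 ≠ 0`. [folklore] -/
private theorem one_ne_zero₃ (n : ℕ) : (1 : Fin (n + 3)) ≠ 0 := by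
  simp

/-- Index bookkeeping in `Fin (n+3)`: `2 ≠ 0`. [folklore] -/
private theorem one_add_one_ne_zero₃ (n : ℕ) : (1 : Fin (n + 3)) + 1 ≠ 0 := by
  rw [Ne, Fin.ext_iff, Fin.val_add, Fin.val_one, Fin.val_zero, Nat.mod_eq_of_lt (by omega)]
  omega

/-- Index bookkeeping in `Fin (n+3)`: `-1 ≠ 1`. [folklore] -/
private theorem neg_one_ne_one₃ (n : ℕ) : (-1 : Fin (n + 3)) ≠ 1 := fun h =>
  one_add_one_ne_zero₃ n (by
    calc (1 : Fin (n + 3)) + 1 = -1 + 1 := by rw [h]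
      _ = 0 := neg_add_cancel 1)

/-- **GGS Theorem 4.1, second statement, for polygons** (p09, verbatim: "when equality holds, every
ℂ-factorization of size `d+1` of `S_P` uses only rank one matrices as factors"; `d = 2`): in a complex
psd factorization of size `3` of the slack matrix of a convex `m`-gon (`m ≥ 3`) every factor is
`vv^*`. Each column `j` (edge `[x_j, x_{j+1}]`) vanishes exactly at the rows `j, j+1` and each row `i`
exactly at the columns `i−1, i`, which is the pattern of `eq_vecMulVec_of_trace_pattern` (applied to
the factorization and to its transpose). [cite: GouchaGouveiaSilva2017, Thm. 4.1 (p09)] -/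
theorem IsConvexPolygon.eq_vecMulVec_of_hasComplexPsdFactorization_three {m : ℕ} [NeZero m]
    {x : Fin m → (Fin 2 → ℝ)} (hx : IsConvexPolygon x) (hm : 3 ≤ m)
    {A B : Fin m → Matrix (Fin 3) (Fin 3) ℂ} (hA : ∀ i, (A i).PosSemidef) (hB : ∀ j, (B j).PosSemidef)
    (hM : ∀ i j, ((polygonSlack x i j : ℝ) : ℂ) = (A i * B j).trace) :
    (∀ i, ∃ a : Fin 3 → ℂ, A i = vecMulVec a (star a)) ∧ ∀ j, ∃ b : Fin 3 → ℂ, B j = vecMulVec b (star b) := by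
  obtain ⟨n, rfl⟩ : ∃ n, m = n + 3 := ⟨m - 3, by omega⟩
  have htr0 : ∀ i j, (A i * B j).trace = 0 ↔ (i = j ∨ i = j + 1) := fun i j => by
    rw [← hM i j, Complex.ofReal_eq_zero, hx.eq_zero_iff]
  -- `j + c₁ = j + c₂` only for `c₁ = c₂`
  have canc : ∀ {j c₁ c₂ : Fin (n + 3)}, j + c₁ = j + c₂ → c₁ = c₂ := fun h => add_left_cancel h
  have h10 := one_ne_zero₃ n
  have h20 := one_add_one_ne_zero₃ n
  have hm11 := neg_one_ne_one₃ n
  refine ⟨fun i => ?_, fun j => ?_⟩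
  · -- row `i`: columns `i` and `i − 1`
    refine eq_vecMulVec_of_trace_pattern (X := B) (Y := A) hB hA (r₁ := i) (r₂ := i + -1) (c := i)
      (c' := i + -1) ?_ ?_ ?_ ?_ ?_
    · rw [trace_mul_comm]; exact (htr0 i i).mpr (Or.inl rfl)
    · rw [trace_mul_comm]
      exact (htr0 i (i + -1)).mpr (Or.inr (by rw [add_assoc, neg_add_cancel, add_zero]))
    · rw [trace_mul_comm]; exact (htr0 (i + -1) (i + -1)).mpr (Or.inl rfl)
    · rw [trace_mul_comm, Ne, htr0, not_or]
      refine ⟨fun h => h10 ?_, fun h => hm11 (canc h)⟩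
      have h' : i + -1 = i + 0 := by rw [add_zero]; exact h
      exact neg_eq_zero.mp (canc h')
    · intro h0
      have h : (A (i + 1) * B (i + -1)).trace = 0 := by rw [h0, Matrix.mul_zero, trace_zero]
      rcases (htr0 _ _).mp h with h | h
      · exact hm11 (canc h).symm
      · rw [add_assoc, neg_add_cancel] at h
        exact h10 (canc h)
  · -- column `j`: rows `j` and `j + 1`
    refine eq_vecMulVec_of_trace_pattern hA hB (r₁ := j) (r₂ := j + 1) (c' := j + 1)
      ((htr0 j j).mpr (Or.inl rfl)) ((htr0 (j + 1) j).mpr (Or.inr rfl))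
      ((htr0 (j + 1) (j + 1)).mpr (Or.inl rfl)) ?_ ?_
    · rw [Ne, htr0, not_or]
      refine ⟨fun h => h10 ?_, fun h => h20 ?_⟩
      · have h' : j + 0 = j + 1 := by rw [add_zero]; exact h
        exact (canc h').symm
      · have h' : j + 0 = j + (1 + 1) := by rw [add_zero, ← add_assoc]; exact h
        exact (canc h').symm
    · intro h0
      have h : (A (j + 1) * B (j + 1 + 1)).trace = 0 := by rw [h0, Matrix.zero_mul, trace_zero]
      rcases (htr0 _ _).mp h with h | h
      · have h' : j + 1 + 0 = j + 1 + 1 := by rw [add_zero]; exact h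
        exact h10 (canc h').symm
      · have h' : j + 1 + 0 = j + 1 + (1 + 1) := by rw [add_zero, ← add_assoc]; exact h
        exact h20 (canc h').symm

/-- **GGS Theorem 4.2 for polygons** (p09, verbatim: "A `d`-polytope `P` with slack matrix `S_P` is
psd^ℂ-minimal if and only if there exists a matrix `M ∈ ℂ^{f×v}` with `rank M = d+1` such that
`S_P = |M| ⊙ |M|`"; `d = 2`, with `M` given through `ℂ³` as `M_{ij} = u_i · v_j`): the slack matrix
of a convex `m`-gon (`m ≥ 3`) has a complex psd factorization of size `3` iff
`S_{ij} = |u_i · v_j|²` for vectors `u_i, v_j ∈ ℂ³`. (`⇐` is `HasComplexPsdFactorization.of_normSq`;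
`⇒` is Theorem 4.1: `A_i = a_ia_i^*`, `B_j = b_jb_j^*`, `Tr(A_iB_j) = |a_i^*b_j|²`.)
[cite: GouchaGouveiaSilva2017, Thm. 4.2 (p09)] -/
theorem IsConvexPolygon.hasComplexPsdFactorization_three_iff {m : ℕ} [NeZero m]
    {x : Fin m → (Fin 2 → ℝ)} (hx : IsConvexPolygon x) (hm : 3 ≤ m) :
    HasComplexPsdFactorization (polygonSlack x) 3 ↔
      ∃ u v : Fin m → Fin 3 → ℂ, ∀ i j, polygonSlack x i j = Complex.normSq (u i ⬝ᵥ v j) := by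
  refine ⟨fun ⟨A, B, hA, hB, hM⟩ => ?_, fun ⟨u, v, h⟩ => HasComplexPsdFactorization.of_normSq u v h⟩
  obtain ⟨hAv, hBv⟩ := hx.eq_vecMulVec_of_hasComplexPsdFactorization_three hm hA hB hM
  choose a ha using hAv
  choose b hb using hBv
  refine ⟨fun i => star (a i), b, fun i j => ?_⟩
  have h := hM i j
  rw [ha i, hb j, trace_vecMulVec_mul_vecMulVec] at h
  exact_mod_cast h

/-! ### Corollary 4.7: the pentagon is not `ℂ`-psd-minimal -/

/-- **GGS Corollary 4.7** (p09, verbatim: "The pentagon is not psd^ℂ-minimal"): the slack matrix of a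
convex pentagon has NO complex psd factorization of size `3 = d + 1`. Proof as printed, assembled:
(i) in a size-`3` ℂ-factorization all factors have rank one (`eq_vecMulVec_of_trace_pattern`, Theorem
4.1), so (ii) `S_P = |M| ⊙ |M|` with `M_{ij} = a_i^* b_j` of rank `≤ 3` (Theorem 4.2), whose `4 × 4`
minors vanish, as do those of `S_P` (`rank S_P = 3`); (iii) the trinomial minors `m_{5,5}, m_{5,1},
m_{3,4}` (`pentagon_trinomial_minors`, in the printed orientation `S_{pp} = S_{p,p+1} = 0`, reached
from the tree's `polygonSlack` by the relabelling `p ↦ −p`) feed Lemma 4.6 and give the contradiction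
`pentagon_trinomial_obstruction`. [cite: GouchaGouveiaSilva2017, Cor. 4.7 (p09–p10)] -/
theorem IsConvexPolygon.not_hasComplexPsdFactorization_three_pentagon {x : Fin 5 → (Fin 2 → ℝ)}
    (hx : IsConvexPolygon x) : ¬ HasComplexPsdFactorization (polygonSlack x) 3 := by
  classical
  rintro ⟨A, B, hA, hB, hM⟩
  have hzero : ∀ i j : Fin 5, polygonSlack x i j = 0 ↔ i = j ∨ i = j + 1 := hx.eq_zero_iff
  have htr0 : ∀ i j, (A i * B j).trace = 0 ↔ (i = j ∨ i = j + 1) := fun i j => by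
    rw [← hM i j, Complex.ofReal_eq_zero, hzero]
  -- (i) rank-one factors
  have hBv : ∀ j, ∃ b : Fin 3 → ℂ, B j = vecMulVec b (star b) := fun j => by
    refine eq_vecMulVec_of_trace_pattern hA hB (r₁ := j) (r₂ := j + 1) (c' := j + 1)
      ((htr0 j j).mpr (Or.inl rfl)) ((htr0 (j + 1) j).mpr (Or.inr rfl))
      ((htr0 (j + 1) (j + 1)).mpr (Or.inl rfl)) ?_ ?_
    · rw [Ne, htr0]; revert j; decide
    · have hne : ¬ (j + 1 = j + 3 ∨ j + 1 = j + 3 + 1) := by revert j; decide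
      intro h0
      have h : (A (j + 1) * B (j + 3)).trace = 0 := by rw [h0, Matrix.zero_mul, trace_zero]
      exact hne ((htr0 _ _).mp h)
  have hAv : ∀ i, ∃ a : Fin 3 → ℂ, A i = vecMulVec a (star a) := fun i => by
    refine eq_vecMulVec_of_trace_pattern (X := B) (Y := A) hB hA (r₁ := i) (r₂ := i + 4) (c := i)
      (c' := i + 4) ?_ ?_ ?_ ?_ ?_
    · rw [trace_mul_comm]; exact (htr0 i i).mpr (Or.inl rfl)
    · rw [trace_mul_comm]; exact (htr0 i (i + 4)).mpr (Or.inr (by revert i; decide))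
    · rw [trace_mul_comm]; exact (htr0 (i + 4) (i + 4)).mpr (Or.inl rfl)
    · rw [trace_mul_comm, Ne, htr0]; revert i; decide
    · have hne : ¬ (i + 2 = i + 4 ∨ i + 2 = i + 4 + 1) := by revert i; decide
      intro h0
      have h : (A (i + 2) * B (i + 4)).trace = 0 := by rw [h0, Matrix.mul_zero, trace_zero]
      exact hne ((htr0 _ _).mp h)
  choose b hb using hBv
  choose a ha using hAv
  -- (ii) `S = |M| ⊙ |M|`, `M = P Q` through `ℂ³`
  let P : Matrix (Fin 5) (Fin 3) ℂ := fun i l => star (a i l)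
  let Q : Matrix (Fin 3) (Fin 5) ℂ := fun l j => b j l
  have hSM : ∀ i j, polygonSlack x i j = Complex.normSq ((P * Q) i j) := fun i j => by
    have h := hM i j
    rw [ha i, hb j, trace_vecMulVec_mul_vecMulVec] at h
    have h' : polygonSlack x i j = Complex.normSq (star (a i) ⬝ᵥ b j) := by exact_mod_cast h
    rw [h']
    rfl
  have hdetM : ∀ f g : Fin 4 → Fin 5, (Matrix.of fun p q => (P * Q) (f p) (g q)).det = 0 :=
    fun f g => det_submatrix_mul_eq_zero P Q f g
  have hdetS : ∀ f g : Fin 4 → Fin 5, (Matrix.of fun p q => polygonSlack x (f p) (g q)).det = 0 :=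
    fun f g => by
    obtain ⟨u, hu, huS⟩ := exists_vecMul_polygonSlack_four x f g
    exact Matrix.exists_vecMul_eq_zero_iff.mp ⟨u, hu, huS⟩
  -- (iii) the printed orientation `p ↦ −p`: zeros at `(p,p)` and `(p,p+1)`
  let σ : Fin 5 → Fin 5 := ![0, 4, 3, 2, 1]
  have hσ0 : ∀ p q : Fin 5, (q = p ∨ q = p + 1) → (σ p = σ q ∨ σ p = σ q + 1) := by decide
  have hσ1 : ∀ p q : Fin 5, q ≠ p → q ≠ p + 1 → ¬ (σ p = σ q ∨ σ p = σ q + 1) := by decide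
  let z : Fin 5 → Fin 5 → ℂ := fun p q => (P * Q) (σ p) (σ q)
  let xs : Fin 5 → Fin 5 → ℝ := fun p q => polygonSlack x (σ p) (σ q)
  have hxz : ∀ p q, xs p q = Complex.normSq (z p q) := fun p q => hSM _ _
  have hx0 : ∀ p q : Fin 5, (q = p ∨ q = p + 1) → xs p q = 0 := fun p q hpq =>
    (hzero _ _).mpr (hσ0 p q hpq)
  have hz0 : ∀ p q : Fin 5, (q = p ∨ q = p + 1) → z p q = 0 := fun p q hpq =>
    Complex.normSq_eq_zero.mp (by rw [← hxz]; exact hx0 p q hpq)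
  have hz1 : ∀ p q : Fin 5, q ≠ p → q ≠ p + 1 → z p q ≠ 0 := fun p q h1 h2 h0 => by
    have h : xs p q ≠ 0 := fun h => hσ1 p q h1 h2 ((hzero _ _).mp h)
    rw [hxz, h0, map_zero] at h
    exact h rfl
  obtain ⟨hA1, hB1, hC1⟩ := pentagon_trinomial_minors z hz0 fun f g => hdetM (σ ∘ f) (σ ∘ g)
  obtain ⟨hA2, hB2, hC2⟩ := pentagon_trinomial_minors xs hx0 fun f g => hdetS (σ ∘ f) (σ ∘ g)
  simp only [hxz, ← Complex.normSq_mul] at hA2 hB2 hC2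
  exact pentagon_trinomial_obstruction z hz1 hA1 hA2 hB1 hB2 hC1 hC2

/-- **The complex psd rank of every convex pentagon is exactly `4`** (Corollary 4.7 with the sandwich
`3 ≤ rank_psd^ℂ ≤ rank_psd^ℝ = 4`: `IsConvexPolygon.three_le_of_hasComplexPsdFactorization`,
`IsConvexPolygon.hasPsdFactorization_four_pentagon`, `HasPsdFactorization.toComplex`).
[cite: GouchaGouveiaSilva2017, Cor. 4.7 (p09)] -/
theorem IsConvexPolygon.complexPsdRank_pentagon {x : Fin 5 → (Fin 2 → ℝ)} (hx : IsConvexPolygon x) :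
    HasComplexPsdFactorization (polygonSlack x) 4 ∧
      ∀ k, HasComplexPsdFactorization (polygonSlack x) k → 4 ≤ k := by
  refine ⟨hx.hasPsdFactorization_four_pentagon.toComplex, fun k hk => ?_⟩
  have h3 : 3 ≤ k := hx.three_le_of_hasComplexPsdFactorization (by norm_num) hk
  by_contra hlt
  have hk3 : k = 3 := by omega
  subst hk3
  exact hx.not_hasComplexPsdFactorization_three_pentagon hk

/-- **GGS Corollary 4.7, as printed**: "The pentagon is not psd^ℂ-minimal" — for every convex pentagon
`rank_psd^ℂ S_P > d + 1 = 3`. [cite: GouchaGouveiaSilva2017, Cor. 4.7 (p09)] -/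
theorem GouchaGouveiaSilva2017_cor47 :
    ∀ x : Fin 5 → (Fin 2 → ℝ), IsConvexPolygon x → ¬ HasComplexPsdFactorization (polygonSlack x) 3 :=
  fun _ hx => hx.not_hasComplexPsdFactorization_three_pentagon

/-! ### Theorem 4.1, first statement, in every dimension (appended)

"Let `S_P` be the slack matrix of a `d`-polytope `P`. Then `rank_psd^ℂ S_P ≥ d+1`" (p09) for
`V`/`H`-described polytopes of any dimension `n ≥ 1`, in the vocabulary of the tree's real version
`add_one_le_of_hasPsdFactorization_slack` / `FawziEtAl2015_cor59` (`PolytopePsdRankLowerBound.lean`):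
the same flag `exists_slack_triangular` (GRT13 Prop. 3.2 unrolled) fed to the COMPLEX psd fooling-set
bound `HasComplexPsdFactorization.card_le_of_triangular` — exactly the paper's "the proofs are omitted
since they are virtually the same as those in [GRT13]". -/

section GeneralDimension

variable {ι κ : Type*} {d : ℕ}

/-- A bounded set contains no ray. [folklore] -/
private theorem eq_zero_of_ray_subset_of_isBounded' {Q : Set (Fin d → ℝ)} (hQ : Bornology.IsBounded Q)
    {y z : Fin d → ℝ} (h : ∀ t : ℝ, 0 ≤ t → y + t • z ∈ Q) : z = 0 := by
  obtain ⟨R, hR⟩ := isBounded_iff_forall_norm_le.mp hQ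
  by_contra hz
  have hzn : 0 < ‖z‖ := norm_pos_iff.mpr hz
  have hy : ‖y‖ ≤ R := by simpa using hR _ (h 0 le_rfl)
  set t : ℝ := (R + ‖y‖ + 1) / ‖z‖ with ht_def
  have ht : 0 ≤ t := div_nonneg (by linarith [norm_nonneg y]) hzn.le
  have hmem := hR _ (h t ht)
  have htz : t * ‖z‖ = R + ‖y‖ + 1 := div_mul_cancel₀ _ hzn.ne'
  have h1 : ‖t • z‖ ≤ ‖y + t • z‖ + ‖y‖ := by
    have := norm_sub_le (y + t • z) y
    rwa [add_sub_cancel_left] at this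
  rw [norm_smul, Real.norm_of_nonneg ht] at h1
  linarith

/-- If some point of the `V`-description is tight on every inequality of the `H`-description, the
polytope is that single point. [folklore] -/
private theorem eq_of_forall_slack_eq_zero' [Finite ι] (x : ι → (Fin d → ℝ)) (a : κ → (Fin d → ℝ))
    (b : κ → ℝ) (hP : convexHull ℝ (Set.range x) = {y | ∀ j, a j ⬝ᵥ y ≤ b j}) {q : ι}
    (hq : ∀ j, a j ⬝ᵥ x q = b j) (i : ι) : x i = x q := by
  have hxP : ∀ i j, a j ⬝ᵥ x i ≤ b j := fun i j => by
    have hi : x i ∈ {y : Fin d → ℝ | ∀ j, a j ⬝ᵥ y ≤ b j} := by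
      rw [← hP]; exact subset_convexHull ℝ _ (Set.mem_range_self i)
    exact hi j
  have hQ : Bornology.IsBounded {y : Fin d → ℝ | ∀ j, a j ⬝ᵥ y ≤ b j} := by
    rw [← hP]; exact isBounded_convexHull.mpr (Set.finite_range x).isBounded
  have hz := eq_zero_of_ray_subset_of_isBounded' hQ (y := x q) (z := x i - x q) fun t ht j => by
    show a j ⬝ᵥ (x q + t • (x i - x q)) ≤ b j
    rw [dotProduct_add, dotProduct_smul, dotProduct_sub, hq j, smul_eq_mul]
    nlinarith [hxP i j]
  exact sub_eq_zero.mp hz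

/-- A positive-dimensional `V`/`H`-polytope has a point of its `V`-description slack on some
inequality. [folklore] -/
private theorem exists_dotProduct_ne_of_finrank_ne_zero' [Finite ι] (x : ι → (Fin d → ℝ))
    (a : κ → (Fin d → ℝ)) (b : κ → ℝ) (hP : convexHull ℝ (Set.range x) = {y | ∀ j, a j ⬝ᵥ y ≤ b j})
    (hD : Module.finrank ℝ (vectorSpan ℝ (Set.range x)) ≠ 0) : ∃ i j, a j ⬝ᵥ x i ≠ b j := by
  have hpq : ∃ p q, x p ≠ x q := by
    by_contra! h
    apply hD
    rcases isEmpty_or_nonempty ι with hι | ⟨⟨q⟩⟩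
    · rw [Set.range_eq_empty x, vectorSpan_empty, finrank_bot]
    · have hrange : Set.range x = {x q} := by
        ext y
        simp only [Set.mem_range, Set.mem_singleton_iff]
        exact ⟨fun ⟨i, hi⟩ => hi ▸ h i q, fun hy => ⟨q, hy.symm⟩⟩
      rw [hrange, vectorSpan_singleton, finrank_bot]
  obtain ⟨p, q, hpq⟩ := hpq
  by_contra! h
  exact hpq (eq_of_forall_slack_eq_zero' x a b hP (q := q) (h q) p)

/-- **GGS Theorem 4.1, first statement, every dimension**: a COMPLEX psd factorization of the slack
matrix `(b_j − a_jᵀx_i)` of a `V`/`H`-described polytope of dimension `n ≥ 1` has size `≥ n + 1`.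
[cite: GouchaGouveiaSilva2017, Thm. 4.1 (p09)] -/
theorem add_one_le_of_hasComplexPsdFactorization_slack [Fintype ι] [Fintype κ]
    (x : ι → (Fin d → ℝ)) (a : κ → (Fin d → ℝ)) (b : κ → ℝ)
    (hP : convexHull ℝ (Set.range x) = {y | ∀ j, a j ⬝ᵥ y ≤ b j}) {n : ℕ}
    (hn : Module.finrank ℝ (vectorSpan ℝ (Set.range x)) = n) (h1 : 1 ≤ n) {k : ℕ}
    (hk : HasComplexPsdFactorization (fun i j => b j - a j ⬝ᵥ x i) k) : n + 1 ≤ k := by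
  obtain ⟨ρ, γ, hdiag, hoff⟩ := exists_slack_triangular n x a b hP hn
    (exists_dotProduct_ne_of_finrank_ne_zero' x a b hP (by omega))
  exact hk.card_le_of_triangular ρ γ (fun t => sub_ne_zero.mpr (hdiag t).symm)
    fun s t hst => sub_eq_zero.mpr (hoff s t hst).symm

/-- **GGS Theorem 4.1, first statement, in the shape of `FawziEtAl2015_cor59`**: for an
`n`-dimensional `V`/`H`-described polytope (`n ≥ 1`) no complex psd factorization of its slack
matrix has size `≤ n`. [cite: GouchaGouveiaSilva2017, Thm. 4.1 (p09)] -/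
theorem GouchaGouveiaSilva2017_thm41 :
    ∀ (d v f n : ℕ) (x : Fin v → (Fin d → ℝ)) (a : Fin f → (Fin d → ℝ)) (b : Fin f → ℝ),
      1 ≤ n → Module.finrank ℝ (vectorSpan ℝ (Set.range x)) = n →
      convexHull ℝ (Set.range x) = {y | ∀ j, a j ⬝ᵥ y ≤ b j} →
        ∀ k ≤ n, ¬ HasComplexPsdFactorization (fun i j => b j - a j ⬝ᵥ x i) k := by
  intro d v f n x a b hn hdim hP k hk hfac
  have := add_one_le_of_hasComplexPsdFactorization_slack x a b hP hdim hn hfac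
  omega

end GeneralDimension

end Literature.Combinatorics.Optimization
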